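import Summits.ABC.IUTFork.Charitable.Thm311D3Concordance
import HarnessLib

/-!
# [IUTchIII] Thm. 3.11 — team D2: EXACTNESS of the charitable typing `Thm311Charitable_2` in the frozen vocabulary

Proof-only record file (D-0012; abc-iut cell, branch D, rung LADDER-ABC:A2.D; seat abc-iut-D2-typ gen 5, team D2 typer / anchor).
TAKES NO SIDE on [IUTchIII] Cor. 3.12 or on any author or team. NO definition, NO `Prop` fact; nothing of any team restated.
It packages, for team D2, the «EXACTNESS» row that `Charitable/Thm311DConcordance.lean` (p436915, abc-iut-D1-typ) gives for teams
D1 (`charitable_1_iff`) and D4 (`charitable_4_iff`) and `Charitable/Thm311D3DeriveIff.lean` (p434033, abc-iut-D3-prv) gives for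
team D3 (`thm311Charitable_3_iff`), using abc-iut-D3-prv's post-lift concordance `Charitable/Thm311D3Concordance.lean` (p436965):
team D2's two non-load-bearing Part (iii) conjuncts `III_ab_UnitPortionLink` ((iii)(a)(b)) and `III_d_NumberFieldLink` ((iii)(d)) are
THEOREMS of the frozen carriers' Thm. 3.11 (i) `MultiradialCompat` (`D3Concordance.unitPortionLink_of_multiradialCompat`,
`numberFieldLink_of_multiradialCompat`, via abc-iut-L6-t13's `MRData.mem_RLGP_iff`), and `III_c_Stabilized` is a carrier tautology
(`III_c_Stabilized_holds`, p428473). Hence: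
* `partIII_minus_square_of_multiradialCompat` — Part (iii) minus the load-bearing square holds OUTRIGHT under frozen (i);
* `charitable_2_iff` — under frozen (i) `MultiradialCompat` and (ii)(b) `KummerB` at every column,
  `Thm311Charitable_2 S P.n qK ⟺ (PartI S ∧ PartII S) ∧ PilotKummerCompat S P qK`:
  team D2's whole maximally-charitable typing = team D2's own paraphrase of (i)/(ii) + abc-iut-w5-d068's clause of record (p420303);
* `charitable_2H_iff` — the hull-level Reading Y variant likewise: `Thm311Charitable_2H ⟺ (PartI ∧ PartII) ∧ PilotKummerCompatHull`
  under frozen (i) alone; so the official typing and its (APT)-respecting variant differ EXACTLY by `PilotKummerCompat` versus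
  `PilotKummerCompatHull` (`charitable_2_iff_2H_and_pilotKummerCompat`, with the two region pins making the hull clause a consequence);
* `charitable_2_iff_of_statement` — the same over the typed Theorem 3.11 `FullSituation.Statement`.
This is the kernel form of the team ledger's «delta vs frozen = ONE corner of ONE square» (HOME/plan/D2/CHARITY-D2.md §4, §12):
everything team D2 typed into Part (iii) beyond the square is carrier-level consequence of the frozen (i). Source: S. Mochizuki,
*Inter-universal Teichmüller theory III* (kurims, May 2020) = `paper:url-4b091feeb646`, Thm. 3.11 pp. 153–159 [claim: Mochizuki2012,
status: disputed]. Typed ≠ proved; derived-under-a-reading ≠ endorsed; locates / conditionally verifies; no abc claim.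
-/

noncomputable section

open Set

namespace Summit.ABC.IUTFork.Charitable.D2

open Thm311 Cor312 Cor312Vol Literature.IUT.LogThetaLattice

section General

variable {T : ThetaIndex} (S : LatticeSituation T) (P : Cor312.Setting S.toSituation)
  (ρ : (∀ v : T.V, v ∈ T.Vbad → Set (S.L.StarPacket v)) → ∀ (j : T.Label) (vQ : T.VQ), Set (S.L.Packet j vQ))
  (qK : ∀ v : T.V, v ∈ T.Vbad → Set (S.L.StarPacket v))

/-- **Part (iii) minus the square holds OUTRIGHT under the frozen (i)**: `III_ab_UnitPortionLink` and `III_d_NumberFieldLink` are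
abc-iut-D3-prv's theorems of `MultiradialCompat` (p436965), `III_c_Stabilized` is the carrier tautology of p428473.
[claim: Mochizuki2012, status: disputed] -/
theorem partIII_minus_square_of_multiradialCompat (hMR : S.MultiradialCompat) :
    III_ab_UnitPortionLink S ∧ III_c_Stabilized S ∧ III_d_NumberFieldLink S :=
  ⟨D3Concordance.unitPortionLink_of_multiradialCompat S hMR, III_c_Stabilized_holds S,
    D3Concordance.numberFieldLink_of_multiradialCompat S hMR⟩

/-- **EXACTNESS for team D2.** Under the frozen carriers' (i) `MultiradialCompat` and (ii)(b) `KummerB` at every column, team D2's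
maximally-charitable typing at the Corollary's line is EXACTLY its own paraphrase of (i)/(ii) together with the clause of record:
`Thm311Charitable_2 S P.n qK ⟺ (PartI S ∧ PartII S) ∧ PilotKummerCompat S P qK` (Part (iii) ⟺ `PilotKummerCompat` is abc-iut-D3-prv's
`D3Concordance.partIII_2_iff_pilotKummerCompat`). [claim: Mochizuki2012, status: disputed] -/
theorem charitable_2_iff (hMR : S.MultiradialCompat) (hKumB : ∀ n : ℤ, (S.col n).KummerB (S.D n)) :
    Thm311Charitable_2 S P.n qK ↔ (PartI S ∧ PartII S) ∧ PilotKummerCompat S P qK := by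
  rw [← D3Concordance.partIII_2_iff_pilotKummerCompat S P qK hMR hKumB]
  exact ⟨fun h => ⟨⟨h.1, h.2.1⟩, h.2.2⟩, fun h => ⟨h.1.1, h.1.2, h.2⟩⟩

/-- **EXACTNESS for the hull-level variant (Reading Y).** Under the frozen (i) alone,
`Thm311Charitable_2H S P ρ qK ⟺ (PartI S ∧ PartII S) ∧ PilotKummerCompatHull S P ρ qK`. [claim: Mochizuki2012, status: disputed] -/
theorem charitable_2H_iff (hMR : S.MultiradialCompat) :
    Thm311Charitable_2H S P ρ qK ↔ (PartI S ∧ PartII S) ∧ PilotKummerCompatHull S P ρ qK :=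
  ⟨fun h => ⟨⟨h.1, h.2.1⟩, h.2.2.2⟩, fun h => ⟨h.1.1, h.1.2, partIII_minus_square_of_multiradialCompat S hMR, h.2⟩⟩

/-- **The official typing and its (APT)-respecting variant differ EXACTLY by the clause of record**: under the frozen (i), (ii)(b) and
the Corollary's two region pins (which make the hull clause a consequence of `PilotKummerCompat`: abc-iut-w5-d068's
`pilotKummerCompatHull_of_region` ∘ `pilotKummerCompatRegion_of_pilotKummerCompat`),
`Thm311Charitable_2 S P.n qK ⟺ Thm311Charitable_2H S P ρ qK ∧ PilotKummerCompat S P qK`. [claim: Mochizuki2012, status: disputed] -/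
theorem charitable_2_iff_2H_and_pilotKummerCompat (hMR : S.MultiradialCompat) (hKumB : ∀ n : ℤ, (S.col n).KummerB (S.D n))
    (hpin : PinnedRegions S P ρ qK) :
    Thm311Charitable_2 S P.n qK ↔ Thm311Charitable_2H S P ρ qK ∧ PilotKummerCompat S P qK := by
  rw [charitable_2_iff S P qK hMR hKumB, charitable_2H_iff S P ρ qK hMR]
  constructor
  · rintro ⟨hI, hc⟩
    exact ⟨⟨hI, pilotKummerCompatHull_of_region S P ρ qK hpin.1
      (pilotKummerCompatRegion_of_pilotKummerCompat S P ρ qK hpin.1.1 hc)⟩, hc⟩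
  · rintro ⟨⟨hI, -⟩, hc⟩
    exact ⟨hI, hc⟩

end General

section Typed

variable {T : ThetaIndex} (F : FullSituation T) (P : Cor312.Setting F.toLatticeSituation.toSituation)
  (ρ : (∀ v : T.V, v ∈ T.Vbad → Set (F.L.StarPacket v)) → ∀ (j : T.Label) (vQ : T.VQ), Set (F.L.Packet j vQ))
  (qK : ∀ v : T.V, v ∈ T.Vbad → Set (F.L.StarPacket v))

/-- **EXACTNESS over the typed Theorem 3.11**: given `FullSituation.Statement` (whose Part (i) carries `MultiradialCompat` and whose
Part (ii) carries `KummerB` at every column), `Thm311Charitable_2 ⟺ (PartI ∧ PartII) ∧ PilotKummerCompat` at the Corollary's line.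
[claim: Mochizuki2012, status: disputed] -/
theorem charitable_2_iff_of_statement (hThm : F.Statement) :
    Thm311Charitable_2 F.toLatticeSituation P.n qK ↔
      (PartI F.toLatticeSituation ∧ PartII F.toLatticeSituation) ∧ PilotKummerCompat F.toLatticeSituation P qK :=
  charitable_2_iff F.toLatticeSituation P qK hThm.1.2.2 fun n => (hThm.2.1 n).2.1

end Typed

end Summit.ABC.IUTFork.Charitable.D2

end
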